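import Literature.AnabelianGeometry.SemiGraphs.MetabelianLeafStarEscape
import HarnessLib

/-!
# The escaping procyclic `⟨c⟩‾ ≤ π₁^temp(𝒢⋆(p))` lies in NO verticial subgroup — PER ELEMENT; and its mod-`p`
# certificate `Φ^{(0)}(c) = −1` («T37iv-ANCHOR-FREE@RAYLESS-STAR», file A)

Mochizuki, *Semi-graphs of anabelioids*, Publ. RIMS **42** (2006), Theorem 3.7 (iii)–(iv) pp. 40–41
[cite: MochizukiSemiAnbd2006, Thm 3.7(iii) pp.40-41].

PROOF-ONLY file (abc-iut cell, layer L3, row «T37iv-ANCHOR-FREE@RAYLESS-STAR» (L3-lead γ81 (b)/γ82 (2)), seat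
abc-iut-L3-t8 gen 7; no definition, no named fact).  abc-iut-L3-t8 gen 6's `metabelianLeafStar_not_compactInVerticialAt`
(`MetabelianLeafStarEscape.lean`, p489415) is stated as the NEGATION of the ∀-typing `CompactInVerticialAt`; its proof
shows, for the SPECIFIC escaping element `c = lim_k c_k` of `exists_escapeLimit P₀` (`MetabelianLeafStarEscapeElement.lean`),
that `⟨c⟩‾` lies in no verticial subgroup of the canonical chart.  The sequel («is `⟨c⟩‾` itself a MAXIMAL compact
subgroup?», file B `MetabelianLeafStarExoticMaximalCompact.lean`) needs that statement PER ELEMENT, so this file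
EXPORTS it, with the same argument (gen 6's leaf case via the twisted abelian character `Φ^{(n)}`, centre case via the
translation characters `ψ̄_n` and the tree walk), for every `c` satisfying the two defining properties delivered by
`exists_escapeLimit` (level components / level actions eventually those of `c_k`):

* `escapeLimit_not_le_range` — for every verticial homomorphism `ψ` at any vertex `v`, `⟨c⟩‾ ⊄ ψ(Π_v)`;
  `escapeLimit_not_le_verticial` — `⟨c⟩‾` lies in no verticial subgroup of the canonical chart;
* `escapeLimit_exists_phi0` — the mod-`p` CERTIFICATE: the torsor character `Φ^{(0)} : π₁^temp(𝒢⋆(p)) → ℤ/p` of the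
  family `leafStarPhi p 0` (abc-iut-L3-t8's `exists_character_D`) kills `ker ρ_j` from some level on and takes the value
  `Φ^{(0)}(c) = Φ^{(0)}_{centre}(a) = −1 ≠ 0` — so `ρ_j(c)` is not a `p`-th power of a `ρ_j`-image of anything `Φ^{(0)}`
  sees (file B uses: every `p`-th power in `Multiplicative (ZMod p)` is trivial, `pow_card_eq_one'`).

Honest framing: OUR typed tempered fundamental group of OUR carrier `𝒢⋆(p)`; print's Thm 3.7 concerns finite `𝔾`, the
only case IUT consumes; nothing here bears on [IUTchIII] Cor. 3.12; no side taken; typed ≠ proved.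
-/

noncomputable section

open CategoryTheory Topology Multiplicative

namespace Literature.AnabelianGeometry.SemiGraphs

open IwahoriWitness

namespace ProfiniteSemiGraph

variable {p : ℕ} [hp : Fact p.Prime] {h36 : (metabelianLeafStar p).Prop36Hypotheses}
  (P₀ : ((metabelianLeafStar p).galoisLevelData h36).PointSeq h36.isCountable (leafStarCentre p))

/-! ### The escaping `⟨c⟩‾` lies in no verticial subgroup (per element) -/

/-- **The escaping procyclic subgroup lies in the image of NO verticial homomorphism** (canonical chart of
`𝒢⋆(p)`): for `c` with `ρ_j(c) = ρ_j(c_k)` and `c`, `c_k` acting alike on `𝒢_{∞,j}` for `k ≥ N j` (the output of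
`exists_escapeLimit P₀`), and any verticial homomorphism `ψ : Π_v → π₁^temp(𝒢⋆(p))`, `⟨c⟩‾ ⊄ ψ(Π_v)`.  Same argument as
abc-iut-L3-t8 gen 6's `metabelianLeafStar_not_compactInVerticialAt` (leaf `n`: `Φ^{(n)}` kills `ψ(Π_{ℓ_n})` but
`Φ^{(n)}(c) = −pⁿ ≠ 0`; centre: the translation characters `ψ̄_n` read `1 (mod p)` on the conjugator for EVERY `n`, while
one adapted level sees only finitely many leaf types on the relevant tree path).
[cite: MochizukiSemiAnbd2006, Thm 3.7(iii) pp.40-41] -/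
theorem escapeLimit_not_le_range (c : ((metabelianLeafStar p).galoisLevelData h36).temperedPi h36.isCountable)
    (N : ℕ → ℕ)
    (hcN : ∀ j k, N j ≤ k → ((metabelianLeafStar p).galoisLevelData h36).proj h36.isCountable j c =
      ((metabelianLeafStar p).galoisLevelData h36).proj h36.isCountable j (escC P₀ k))
    (hact : ∀ j k, N j ≤ k → ((metabelianLeafStar p).galoisLevelData h36).treeAct h36.isCountable j c =
      ((metabelianLeafStar p).galoisLevelData h36).treeAct h36.isCountable j (escC P₀ k))
    {v : (metabelianLeafStar p).graph.Vertex}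
    {ψ : (metabelianLeafStar p).Gv v →ₜ* ((metabelianLeafStar p).temperedPiChart h36).G}
    (hψ : IsVerticialHom ((metabelianLeafStar p).temperedPiChart h36) v ψ) :
    ¬ (Subgroup.zpowers c).topologicalClosure ≤ ψ.toMonoidHom.range := by
  classical
  intro hCH
  haveI : NeZero p := ⟨hp.out.ne_zero⟩
  have hcC : c ∈ (Subgroup.zpowers c).topologicalClosure :=
    Subgroup.le_topologicalClosure _ (Subgroup.mem_zpowers c)
  obtain ⟨P, hP⟩ := exists_pointSeq_of_isVerticialHom (h36 := h36) (v := v) (ψ := ψ) hψ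
  obtain ⟨f, hf⟩ := hCH hcC
  have hcP : P.decompHom f = c := by rw [hP]; exact hf
  -- characters read `c` through `y = ψ₀(a)`
  have hread : ∀ {A : Type} [CommGroup A]
      (χ : ((metabelianLeafStar p).galoisLevelData h36).temperedPi h36.isCountable →* A) (j : ℕ),
      (∀ g, ((metabelianLeafStar p).galoisLevelData h36).proj h36.isCountable j g = 1 → χ g = 1) → χ c = χ (psi0 P₀ (FreeProPRankTwo.a p)) := by
    intro A _ χ j hker
    have h1 : χ (c * (escC P₀ (N j))⁻¹) = 1 := hker _ (by rw [map_mul, map_inv, hcN j (N j) le_rfl, mul_inv_cancel])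
    rw [map_mul, map_inv, mul_inv_eq_one] at h1
    rw [h1, escC, map_mul, map_mul, map_inv, mul_inv_cancel_comm]
    rfl
  cases v with
  | some n =>
    -- LEAF `n`: the twisted abelian character `Φ^{(n)}` kills `ψ_P(Leaf n) ∋ c`, but `Φ^{(n)}(c) = Φ^{(n)}(a) ≠ 1`
    obtain ⟨Φ, hΦP, -, j₂, hj₂⟩ := exists_character_D h36 (leafStarPhiV p n) (leafStarPhiE p n)
      (leafStarPhi_compatible p n)
    have h1 : Φ c = 1 := by rw [← hcP, hΦP]; exact leafStarPhiV_leaf_self n f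
    have h2 : Φ c ≠ 1 := by
      rw [hread Φ j₂ hj₂, show Φ (psi0 P₀ (FreeProPRankTwo.a p)) =
        leafStarPhiV p n (leafStarCentre p) (FreeProPRankTwo.a p) from hΦP (leafStarCentre p) P₀ _]
      exact leafStarPhiV_centre_a_ne_one p n
    exact h2 h1
  | none =>
    -- CENTRE: `P = g·P₀`, so `c` fixes `(g·P₀).vertex M` at every level `M`
    obtain ⟨g, rfl⟩ := P₀.exists_smul_eq P
    have hfixg : ∀ M, (((metabelianLeafStar p).galoisLevelData h36).treeAct h36.isCountable M c).hom.vertexMap ((P₀.smul g).vertex M) =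
        (P₀.smul g).vertex M := fun M => by
      rw [← hcP]; exact (P₀.smul g).treeAct_decompHom_vertexMap M f
    -- for every `n`: the translation character `ψ̄_n` (mod `p`) takes the value `1 (mod p)` on `g`
    have key : ∀ (n : ℕ) (χ : ((metabelianLeafStar p).galoisLevelData h36).temperedPi h36.isCountable →* Multiplicative (ZMod (p ^ 1))),
        (∀ (w : (metabelianLeafStar p).graph.Vertex) (Q : ((metabelianLeafStar p).galoisLevelData h36).PointSeq h36.isCountable w)
          (h : (metabelianLeafStar p).Gv w),
          χ (Q.decompHom h) = leafStarPsiV p n 1 (Nat.succ_le_succ (Nat.zero_le n)) w h) →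
        (∃ j₁ : ℕ, ∀ g', ((metabelianLeafStar p).galoisLevelData h36).proj h36.isCountable j₁ g' = 1 → χ g' = 1) → χ g = ofAdd 1 := by
      intro n χ hχP hχj
      obtain ⟨j₁, hj₁⟩ := hχj
      obtain ⟨Φ, hΦP, -, j₂, hj₂⟩ := exists_character_D h36 (leafStarPhiV p n) (leafStarPhiE p n)
        (leafStarPhi_compatible p n)
      have hχleaf : ∀ (m : ℕ) (l : Iw.Leaf (p := p) m),
          χ (psiLeaf P₀ m l) = leafStarPsiV p n 1 (Nat.succ_le_succ (Nat.zero_le n)) (leafStarLeaf p m) l :=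
        fun m l => hχP (leafStarLeaf p m) (leafSeq P₀ m) l
      have hΦ0 : ∀ f' : FreeProPRankTwo.Grp p, Φ (psi0 P₀ f') = leafStarPhiV p n (leafStarCentre p) f' :=
        fun f' => hΦP (leafStarCentre p) P₀ f'
      -- the level and the index
      have hkerχ : ∀ g', ((metabelianLeafStar p).galoisLevelData h36).proj h36.isCountable (max j₁ j₂) g' = 1 → χ g' = 1 :=
        fun g' hg' => hj₁ g' (proj_eq_one_of_le (le_max_left _ _) g' hg')
      have hkerΦ : ∀ g', ((metabelianLeafStar p).galoisLevelData h36).proj h36.isCountable (max j₁ j₂) g' = 1 → Φ g' = 1 :=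
        fun g' hg' => hj₂ g' (proj_eq_one_of_le (le_max_right _ _) g' hg')
      have h0 : ∀ f' : FreeProPRankTwo.Grp p, χ (psi0 P₀ f') = 1 := fun f' => hχP _ P₀ f'
      have hleaf : ∀ m, m ≠ n → ∀ l : Iw.Leaf (p := p) m, χ (psiLeaf P₀ m l) = 1 := by
        intro m hm l
        rw [hχleaf]
        exact leafStarPsiV_leaf_ne p n 1 _ hm l
      have hΦc : Φ c ≠ 1 := by
        rw [hread Φ j₂ hj₂, hΦ0]
        exact leafStarPhiV_centre_a_ne_one p n
      have hΦbr : ∀ (f' : FreeProPRankTwo.Grp p) (t : Multiplicative ℤ_[p]),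
          Φ (psi0 P₀ (f' * FreeProPRankTwo.θα p n t * f'⁻¹)) = 1 := by
        intro f' t
        rw [hΦ0]
        exact linChar_conj_θα n f' t
      -- `c` acts at level `M := max j₁ j₂` like `c_k`, `k := max (N M) n`; both ends of the path are `c`-fixed
      have hfix1 : (((metabelianLeafStar p).galoisLevelData h36).treeAct h36.isCountable (max j₁ j₂) c).hom.vertexMap
          ((P₀.smul (escH P₀ (max (N (max j₁ j₂)) n))).vertex (max j₁ j₂)) =
          (P₀.smul (escH P₀ (max (N (max j₁ j₂)) n))).vertex (max j₁ j₂) := by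
        rw [hact (max j₁ j₂) _ (le_max_left _ _)]; exact treeAct_escC_vertexMap P₀ _ _
      have hfix2 := hfixg (max j₁ j₂)
      -- the fixed path
      have hT := (((metabelianLeafStar p).galoisLevelData h36).isTree_tree (max j₁ j₂)).isTree
      obtain ⟨w⟩ := hT.connected (Sum.inl ((P₀.smul (escH P₀ (max (N (max j₁ j₂)) n))).vertex (max j₁ j₂)) :
        (((metabelianLeafStar p).galoisLevelData h36).tree (max j₁ j₂)).Node) (Sum.inl ((P₀.smul g).vertex (max j₁ j₂)))
      have hnode : ∀ z ∈ w.bypass.support, SemiGraph.nodeMap (((metabelianLeafStar p).galoisLevelData h36).treeAct h36.isCountable (max j₁ j₂) c) z = z :=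
        SemiGraph.nodeMap_eq_self_of_isPath hT.isAcyclic _ (by simp [hfix1]) (by simp [hfix2]) w.bypass
          w.bypass_isPath
      have havoid : ∀ (a : ((metabelianLeafStar p).galoisLevelData h36).temperedPi h36.isCountable) (β : (((metabelianLeafStar p).galoisLevelData h36).tree (max j₁ j₂)).Branch),
          (((metabelianLeafStar p).galoisLevelData h36).tree (max j₁ j₂)).abuts β = some ((P₀.smul a).vertex (max j₁ j₂)) →
          (Sum.inr (Sum.inr β) : (((metabelianLeafStar p).galoisLevelData h36).tree (max j₁ j₂)).Node) ∈ w.bypass.support →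
          (((metabelianLeafStar p).galoisLevelData h36).treeProj (max j₁ j₂)).branchMap β ≠ ((n, true) : ℕ × Bool) := by
        intro a β hβ hmem hβb
        have hfixβ := hnode _ hmem
        rw [SemiGraph.nodeMap_inr_inr, Sum.inr.injEq, Sum.inr.injEq] at hfixβ
        have hedge : (((metabelianLeafStar p).galoisLevelData h36).treeAct h36.isCountable (max j₁ j₂) c).hom.edgeMap ((((metabelianLeafStar p).galoisLevelData h36).tree (max j₁ j₂)).edgeOf β) =
            (((metabelianLeafStar p).galoisLevelData h36).tree (max j₁ j₂)).edgeOf β := by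
          rw [← (((metabelianLeafStar p).galoisLevelData h36).treeAct h36.isCountable (max j₁ j₂) c).hom.edgeOf_branchMap β, hfixβ]
        exact edgeMap_edgeOf_ne_of_ne_one P₀ Φ (max j₁ j₂) n hkerΦ hΦbr c hΦc a β hβb hβ hedge
      have hwalk := chi_eq_of_walk P₀ χ (max j₁ j₂) hkerχ h0 n hleaf (escH P₀ (max (N (max j₁ j₂)) n)) g
        w.bypass w.bypass_isPath havoid
      -- `χ(h_k) = 1 (mod p)` since `k ≥ n`
      have hχM : ∀ i, χ (escM P₀ i) = if i = n then ofAdd 1 else 1 := by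
        intro i
        rw [escM, hχleaf]
        by_cases hi : i = n
        · subst hi; rw [if_pos rfl]; exact leafStarPsiV_translLeaf p i 1 _
        · rw [if_neg hi]; exact leafStarPsiV_leaf_ne p n 1 _ hi _
      rw [← hwalk, chi_escH P₀ χ n (ofAdd 1) hχM, if_pos (le_max_right _ _)]
    -- ONE level adapted to all `ψ̄_n`; the path from `P₀.vertex` to `(g·P₀).vertex` there meets finitely many types
    obtain ⟨i₁, hi₁⟩ := exists_level_adaptedTo_leafStarPsi p h36
    have hT := (((metabelianLeafStar p).galoisLevelData h36).isTree_tree i₁).isTree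
    obtain ⟨w⟩ := hT.connected (Sum.inl ((P₀.smul 1).vertex i₁) : (((metabelianLeafStar p).galoisLevelData h36).tree i₁).Node)
      (Sum.inl ((P₀.smul g).vertex i₁))
    -- the finitely many leaf types read at the branch nodes of the path
    let types : Finset ℕ := (w.bypass.support.filterMap fun z =>
      match z with
      | Sum.inr (Sum.inr β) => some ((((metabelianLeafStar p).galoisLevelData h36).treeProj i₁).branchMap β).1
      | _ => none).toFinset
    obtain ⟨n, hn⟩ := Infinite.exists_notMem_finset types
    have havoid : ∀ (a : ((metabelianLeafStar p).galoisLevelData h36).temperedPi h36.isCountable) (β : (((metabelianLeafStar p).galoisLevelData h36).tree i₁).Branch),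
        (((metabelianLeafStar p).galoisLevelData h36).tree i₁).abuts β = some ((P₀.smul a).vertex i₁) →
        (Sum.inr (Sum.inr β) : (((metabelianLeafStar p).galoisLevelData h36).tree i₁).Node) ∈ w.bypass.support →
        (((metabelianLeafStar p).galoisLevelData h36).treeProj i₁).branchMap β ≠ ((n, true) : ℕ × Bool) := by
      intro a β _ hmem hβb
      apply hn
      rw [List.mem_toFinset, List.mem_filterMap]
      exact ⟨Sum.inr (Sum.inr β), hmem, by simp only [hβb]⟩
    -- the character `ψ̄_n`, adapted at `i₁`
    obtain ⟨χ, hχP, hχadapt, hχj⟩ := exists_character_D h36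
      (leafStarPsiV p n 1 (Nat.succ_le_succ (Nat.zero_le n))) (leafStarPsiE p 1) (leafStarPsi_compatible p n 1 _)
    have hker : ∀ g', ((metabelianLeafStar p).galoisLevelData h36).proj h36.isCountable i₁ g' = 1 → χ g' = 1 := hχadapt i₁ (hi₁ i₁ le_rfl n)
    have h0 : ∀ f' : FreeProPRankTwo.Grp p, χ (psi0 P₀ f') = 1 := fun f' => hχP _ P₀ f'
    have hleaf : ∀ m, m ≠ n → ∀ l : Iw.Leaf (p := p) m, χ (psiLeaf P₀ m l) = 1 := by
      intro m hm l
      exact (hχP (leafStarLeaf p m) (leafSeq P₀ m) l).trans (leafStarPsiV_leaf_ne p n 1 _ hm l)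
    have hwalk := chi_eq_of_walk P₀ χ i₁ hker h0 n hleaf 1 g w.bypass w.bypass_isPath havoid
    rw [map_one, key n χ hχP hχj] at hwalk
    -- `1 = ofAdd 1` in `ℤ/p`: absurd
    have h01 : (1 : ZMod (p ^ 1)) = 0 := by
      have := congrArg Multiplicative.toAdd hwalk
      rwa [toAdd_one, toAdd_ofAdd, eq_comm] at this
    haveI : Fact (1 < p ^ 1) := ⟨by rw [pow_one]; exact hp.out.one_lt⟩
    exact one_ne_zero h01

/-- **The escaping `⟨c⟩‾` lies in NO verticial subgroup** of the canonical chart of `𝒢⋆(p)` (subgroup form of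
`escapeLimit_not_le_range`). [cite: MochizukiSemiAnbd2006, Thm 3.7(iii) pp.40-41] -/
theorem escapeLimit_not_le_verticial (c : ((metabelianLeafStar p).galoisLevelData h36).temperedPi h36.isCountable)
    (N : ℕ → ℕ)
    (hcN : ∀ j k, N j ≤ k → ((metabelianLeafStar p).galoisLevelData h36).proj h36.isCountable j c =
      ((metabelianLeafStar p).galoisLevelData h36).proj h36.isCountable j (escC P₀ k))
    (hact : ∀ j k, N j ≤ k → ((metabelianLeafStar p).galoisLevelData h36).treeAct h36.isCountable j c =
      ((metabelianLeafStar p).galoisLevelData h36).treeAct h36.isCountable j (escC P₀ k))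
    {v : (metabelianLeafStar p).graph.Vertex} {H : Subgroup ((metabelianLeafStar p).temperedPiChart h36).G}
    (hH : H ∈ verticialSubgroups ((metabelianLeafStar p).temperedPiChart h36) v) :
    ¬ (Subgroup.zpowers c).topologicalClosure ≤ H := by
  obtain ⟨ψ, hψ, rfl⟩ := hH
  exact escapeLimit_not_le_range P₀ c N hcN hact hψ

/-! ### The mod-`p` certificate `Φ^{(0)}(c) = −1` -/

/-- **The certificate**: the torsor character `Φ^{(0)} : π₁^temp(𝒢⋆(p)) →* ℤ/p` of the compatible family
`(leafStarPhiV p 0, leafStarPhiE p 0)` (abc-iut-L3-t8's `exists_character_D`) satisfies: it is `Φ^{(0)}_w ∘ ψ_Q` on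
every decomposition homomorphism, it kills `ker ρ_j` for every `j` beyond some `j₁`, and `Φ^{(0)}(c) = ofAdd (−1) ≠ 1`
(read through `y = ψ₀(a)`, `leafStarPhiV_centre_a`).  Consequently `ρ_j(c)` is never a `p`-th power of a `ρ_j`-image,
since `p`-th powers die in `ℤ/p`. [cite: MochizukiSemiAnbd2006, Thm 3.7(iii) pp.40-41] -/
theorem escapeLimit_exists_phi0 (c : ((metabelianLeafStar p).galoisLevelData h36).temperedPi h36.isCountable)
    (N : ℕ → ℕ)
    (hcN : ∀ j k, N j ≤ k → ((metabelianLeafStar p).galoisLevelData h36).proj h36.isCountable j c =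
      ((metabelianLeafStar p).galoisLevelData h36).proj h36.isCountable j (escC P₀ k)) :
    ∃ (Φ : ((metabelianLeafStar p).galoisLevelData h36).temperedPi h36.isCountable →* Multiplicative (ZMod (p ^ 1)))
      (j₁ : ℕ),
      (∀ (w : (metabelianLeafStar p).graph.Vertex)
        (Q : ((metabelianLeafStar p).galoisLevelData h36).PointSeq h36.isCountable w) (h : (metabelianLeafStar p).Gv w),
        Φ (Q.decompHom h) = leafStarPhiV p 0 w h) ∧
      (∀ j, j₁ ≤ j → ∀ g, ((metabelianLeafStar p).galoisLevelData h36).proj h36.isCountable j g = 1 → Φ g = 1) ∧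
      Φ c = ofAdd (-1) ∧ Φ c ≠ 1 := by
  haveI : NeZero p := ⟨hp.out.ne_zero⟩
  obtain ⟨Φ, hΦP, -, j₁, hj₁⟩ := exists_character_D h36 (leafStarPhiV p 0) (leafStarPhiE p 0)
    (leafStarPhi_compatible p 0)
  have hker : ∀ j, j₁ ≤ j → ∀ g, ((metabelianLeafStar p).galoisLevelData h36).proj h36.isCountable j g = 1 → Φ g = 1 :=
    fun j hj g hg => hj₁ g (proj_eq_one_of_le hj g hg)
  -- `Φ(c) = Φ(ψ₀(a))`: read at level `j₁` through `c_{N j₁} = h · ψ₀(a) · h⁻¹`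
  have hread : Φ c = Φ (psi0 P₀ (FreeProPRankTwo.a p)) := by
    have h1 : Φ (c * (escC P₀ (N j₁))⁻¹) = 1 :=
      hj₁ _ (by rw [map_mul, map_inv, hcN j₁ (N j₁) le_rfl, mul_inv_cancel])
    rw [map_mul, map_inv, mul_inv_eq_one] at h1
    rw [h1, escC, map_mul, map_mul, map_inv, mul_inv_cancel_comm]
    rfl
  have hval : Φ c = ofAdd (-1) := by
    rw [hread, show Φ (psi0 P₀ (FreeProPRankTwo.a p)) = leafStarPhiV p 0 (leafStarCentre p) (FreeProPRankTwo.a p)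
      from hΦP (leafStarCentre p) P₀ _, leafStarPhiV_centre_a, pow_zero]
  refine ⟨Φ, j₁, hΦP, hker, hval, ?_⟩
  rw [hread, show Φ (psi0 P₀ (FreeProPRankTwo.a p)) = leafStarPhiV p 0 (leafStarCentre p) (FreeProPRankTwo.a p)
    from hΦP (leafStarCentre p) P₀ _]
  exact leafStarPhiV_centre_a_ne_one p 0

/-- In `ℤ/p` (multiplicative notation) every `p`-th power is trivial — the arithmetic behind the certificate.
[cite: MochizukiSemiAnbd2006, Thm 3.7(iii) pp.40-41] -/
theorem pow_prime_eq_one_zmod (x : Multiplicative (ZMod (p ^ 1))) : x ^ p = 1 := by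
  have h : Nat.card (Multiplicative (ZMod (p ^ 1))) = p := by
    rw [Nat.card_eq_fintype_card, Fintype.card_multiplicative, ZMod.card, pow_one]
  have h2 : x ^ Nat.card (Multiplicative (ZMod (p ^ 1))) = 1 := pow_card_eq_one'
  rwa [h] at h2

end ProfiniteSemiGraph

end Literature.AnabelianGeometry.SemiGraphs

end
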